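/-
Copyright (c) 2026 the pub-hodgecm-mathlib formalisation cell (harness21).  Prover seat hodgecm-mathlib-B-p14 (g32) — (R2) glue ∕ assembly heir, 2026-09-01.
ROAD W (W6-E): Kottwitz's elliptic relation at the ramified levels `(K♯_D, K, K♯_D ⊓ K)` of `U(Φ₂)(L⁺_v)` from ANY vertex-transitive, dart-transitive action of
`U₂` on a tree whose vertex ∕ edge stabilisers are `K♯_D` and `K` (in either order) — statement-first over B-p08 (g28)'s (W1c)(W2).
-/
import Literature.NumberTheory.Rogawski1990.RankOneEulerPoincareNonsplitRamifiedPackage   -- ★ (B-p14 g32) p843499: the levels `K♯_D`, `mem_comap_map_conj_glInt_iff`, `isCompact_isOpen_comap_map_conj_glInt`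
import Literature.Combinatorics.SimpleGraph.TreeActionEulerRelation                     -- ★ (B-p14 g32) p843694: `natCard_fixedBy_add_eq_natCard_fixedBy_add_one_of_vertexAction`
import Literature.NumberTheory.Automorphic.FixedCosetsFiniteOfCompactCentralizer        -- ★ (B-p04 g35) p843428: `finite_fixedBy_quotient_and_of_isClosed`
import Literature.NumberTheory.Automorphic.UnitaryUnitOrbitalIntegralFixedPoints        -- ★ `isClosed_conjClass_local_of_isRegularElt` (via `LocalRegularOrbitClosed`), the `U(H)(L⁺_v)` instances
import HarnessLib

/-!
# The elliptic Euler–Poincaré relation at the ramified levels of `U(Φ₂)(L⁺_v)` from a tree action (ROAD W, wild places included)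

Topic `NumberTheory/Rogawski1990`, namespace `Literature.NumberTheory.Rogawski1990`.  THEOREMS ONLY: no definition, no named fact, no instance, no notation,
no `sorry`; kernel lane.

THE MATHEMATICS [Kottwitz1988, §2; Serre1980Trees, II.1.1–1.3; Tits1979, §2.7; F0P3a-p04 (g13) MEMO «R2EP-wild» §1 (S1)–(S5)].  At EVERY ramified non-split
place `w ∣ v` (tame or wild) `U₂ = U(Φ₂)(L⁺_v)` acts — through `ρ : U(Φ₂)(E_w) → PGL₂(F_v)` (★ p843570) — on the tree `X` of `SL₂(F_v)` (★ p843564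
`latticeTree id ϖ_F J`) with ONE orbit of vertices, ONE orbit of darts (inversions), the two stabilisers being the lattice stabilisers `K = U₂ ∩ GL₂(𝒪_w)` and
`K♯_D = U₂ ∩ D GL₂(𝒪_w) D⁻¹` (`D = diag(1, ϖ_E)`) in an order depending on the type of `E_w ∕ F_v` (S4).  THIS FILE takes such an action as HYPOTHESES (any tree
`X`, any action `act` of `U₂` on its vertices with `act 1 = id`, `act (gh) = act g ∘ act h`, adjacency preserved, vertex- and dart-transitive, and the two
stabiliser identifications through the one-place model `e_w`) and concludes Kottwitz's ELLIPTIC relation at `(K♯_D, K, K♯_D ⊓ K)` for every regular elliptic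
`γ ∈ U₂`: `#Fix(U₂⧸K♯_D) + #Fix(U₂⧸K) = #Fix(U₂⧸(K♯_D ⊓ K)) + 1` — the `hE` input of ★ `exists_epRelations_of_vertexEdgeLevels` (p843499) — by the generic tree
relation ★ `TreeAction.natCard_fixedBy_add_eq_natCard_fixedBy_add_one_of_vertexAction` (p843694; inversions allowed), the finiteness triple ★ p843428 and the
closed regular class ★ `isClosed_conjClass_local_of_isRegularElt`.  Two versions: `K♯_D` the VERTEX stabiliser (`E_w = F_v(√π)`-type, all tame places) and `K`
the vertex stabiliser (`F_v(√u)`-type).  The action itself ((W1c)(W2), B-p08 (g28)) instantiates the binders.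
HONEST LABEL: HC_CM is proved only modulo the cell's remaining named inputs (hLiu418, h413) until rung 0 closes; this file is unconditional.

## References
* [Kottwitz1988] R. E. Kottwitz, *Tamagawa numbers*, Ann. of Math. 127 (1988), 629–646, §2 Theorem 2.
* [Serre1980Trees] J.-P. Serre, *Trees* (1980), Ch. II §1.1–§1.3.
* [Tits1979] J. Tits, *Reductive groups over local fields*, PSPM 33.1 (1979), §2.7 (ramified quasi-split unitary groups: the building is the tree of `SL₂`).
-/

set_option autoImplicit false

noncomputable section

open scoped ValuativeRel Matrix MatrixGroups
open Matrix ValuativeRel NumberField IsDedekindDomain MulAction MeasureTheory Measure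

namespace Literature.NumberTheory.Rogawski1990

open Literature.NumberTheory.Automorphic Literature.NumberTheory.Automorphic.UnitaryGroup Literature.Combinatorics.SimpleGraph

section WildElliptic

variable (L : Type) [Field L] [NumberField L] [IsCMField L] {v : HeightOneSpectrum (𝓞 ↥(maximalRealSubfield L))}
  (w : PlacesOver L v) (hw : IsCMField.complexConj L • w.1 = w.1) (D : GL (Fin 2) (w.1.adicCompletion L))

include hw in
/-- **(E) AT `(K♯_D, K, K♯_D ⊓ K)` FROM A TREE ACTION WITH `K♯_D` THE VERTEX STABILISER AND `K` THE EDGE STABILISER** (`√π`-type: all tamely ramified places and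
the wild places with an anti-fixed uniformiser).  `act` = any action of `U₂` on the vertices of a tree `X` (`act_one`, `act_mul`, `act_adj`), transitive on vertices
(`hV`) and on darts (`hD`), with `g ∈ K♯_D ↔ act g x₀ = x₀` and `g ∈ K ↔ act g {x₀,x₁} = {x₀,x₁}` read through `e_w`; then for every regular elliptic `γ`:
`#Fix(U₂⧸K♯_D) + #Fix(U₂⧸K) = #Fix(U₂⧸(K♯_D ⊓ K)) + 1`. [cite: Kottwitz1988, §2 Theorem 2] [cite: Serre1980Trees, II.1.3] [cite: Tits1979, §2.7] -/
theorem epEllipticRelation_vertexEdgeLevels_of_vertexAction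
    {W : Type*} {X : SimpleGraph W} (hX : X.IsTree) (act : (cmDatum L 2 (Matrix.of fun i j : Fin 2 => if i.val + j.val + 1 = 2 then (1 : L) else 0)).Local v → W → W)
    (act_one : ∀ x : W, act 1 x = x) (act_mul : ∀ (g h : (cmDatum L 2 (Matrix.of fun i j : Fin 2 => if i.val + j.val + 1 = 2 then (1 : L) else 0)).Local v) (x : W), act (g * h) x = act g (act h x))
    (act_adj : ∀ (g : (cmDatum L 2 (Matrix.of fun i j : Fin 2 => if i.val + j.val + 1 = 2 then (1 : L) else 0)).Local v) (a b : W), X.Adj (act g a) (act g b) ↔ X.Adj a b)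
    {x₀ x₁ : W} (h01 : X.Adj x₀ x₁) (hV : ∀ x : W, ∃ g : (cmDatum L 2 (Matrix.of fun i j : Fin 2 => if i.val + j.val + 1 = 2 then (1 : L) else 0)).Local v, act g x₀ = x)
    (hD : ∀ a b : W, X.Adj a b → ∃ g : (cmDatum L 2 (Matrix.of fun i j : Fin 2 => if i.val + j.val + 1 = 2 then (1 : L) else 0)).Local v, act g x₀ = a ∧ act g x₁ = b)
    (hKv : ∀ g : (cmDatum L 2 (Matrix.of fun i j : Fin 2 => if i.val + j.val + 1 = 2 then (1 : L) else 0)).Local v, (((localNonsplitEquiv (IsCMField.complexConj L) (Matrix.of fun i j : Fin 2 => if i.val + j.val + 1 = 2 then (1 : L) else 0)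
          (IsCMField.complexConj_ne_one L) w hw) g : ↥(unitaryGroupOfForm (galAdicCompletionMap (L := L) (IsCMField.complexConj L) hw)
            (placeForm (Matrix.of fun i j : Fin 2 => if i.val + j.val + 1 = 2 then (1 : L) else 0) w.1))) : GL (Fin 2) (w.1.adicCompletion L)) ∈
        (glInt 2 (w.1.adicCompletion L)).map (MulAut.conj D).toMonoidHom ↔ act g x₀ = x₀)
    (hKe : ∀ g : (cmDatum L 2 (Matrix.of fun i j : Fin 2 => if i.val + j.val + 1 = 2 then (1 : L) else 0)).Local v, (((localNonsplitEquiv (IsCMField.complexConj L) (Matrix.of fun i j : Fin 2 => if i.val + j.val + 1 = 2 then (1 : L) else 0)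
          (IsCMField.complexConj_ne_one L) w hw) g : ↥(unitaryGroupOfForm (galAdicCompletionMap (L := L) (IsCMField.complexConj L) hw)
            (placeForm (Matrix.of fun i j : Fin 2 => if i.val + j.val + 1 = 2 then (1 : L) else 0) w.1))) : GL (Fin 2) (w.1.adicCompletion L)) ∈
        glInt 2 (w.1.adicCompletion L) ↔ s(act g x₀, act g x₁) = s(x₀, x₁))
    (γ : (cmDatum L 2 (Matrix.of fun i j : Fin 2 => if i.val + j.val + 1 = 2 then (1 : L) else 0)).Local v) (hreg : IsRegularElt (γ.val : GL (Fin 2) (UnitaryGroup.LocalRing L v)))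
    (hc : CompactSpace (Subgroup.centralizer ({γ} : Set ((cmDatum L 2 (Matrix.of fun i j : Fin 2 => if i.val + j.val + 1 = 2 then (1 : L) else 0)).Local v)))) :
    Nat.card (fixedBy ((cmDatum L 2 (Matrix.of fun i j : Fin 2 => if i.val + j.val + 1 = 2 then (1 : L) else 0)).Local v ⧸
          (((glInt 2 (w.1.adicCompletion L)).map (MulAut.conj D).toMonoidHom).comap
          (((unitaryGroupOfForm (galAdicCompletionMap (L := L) (IsCMField.complexConj L) hw)
            (placeForm (Matrix.of fun i j : Fin 2 => if i.val + j.val + 1 = 2 then (1 : L) else 0) w.1)).subtype.comp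
            (localNonsplitEquiv (IsCMField.complexConj L) (Matrix.of fun i j : Fin 2 => if i.val + j.val + 1 = 2 then (1 : L) else 0)
          (IsCMField.complexConj_ne_one L) w hw).toMonoidHom :
            (cmDatum L 2 (Matrix.of fun i j : Fin 2 => if i.val + j.val + 1 = 2 then (1 : L) else 0)).Local v →* GL (Fin 2) (w.1.adicCompletion L))))) γ) +
        Nat.card (fixedBy ((cmDatum L 2 (Matrix.of fun i j : Fin 2 => if i.val + j.val + 1 = 2 then (1 : L) else 0)).Local v ⧸
          cmLocalIntegralLevel L 2 (Matrix.of fun i j : Fin 2 => if i.val + j.val + 1 = 2 then (1 : L) else 0) v) γ) =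
      Nat.card (fixedBy ((cmDatum L 2 (Matrix.of fun i j : Fin 2 => if i.val + j.val + 1 = 2 then (1 : L) else 0)).Local v ⧸
          ((((glInt 2 (w.1.adicCompletion L)).map (MulAut.conj D).toMonoidHom).comap
          (((unitaryGroupOfForm (galAdicCompletionMap (L := L) (IsCMField.complexConj L) hw)
            (placeForm (Matrix.of fun i j : Fin 2 => if i.val + j.val + 1 = 2 then (1 : L) else 0) w.1)).subtype.comp
            (localNonsplitEquiv (IsCMField.complexConj L) (Matrix.of fun i j : Fin 2 => if i.val + j.val + 1 = 2 then (1 : L) else 0)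
          (IsCMField.complexConj_ne_one L) w hw).toMonoidHom :
            (cmDatum L 2 (Matrix.of fun i j : Fin 2 => if i.val + j.val + 1 = 2 then (1 : L) else 0)).Local v →* GL (Fin 2) (w.1.adicCompletion L)))) ⊓
            cmLocalIntegralLevel L 2 (Matrix.of fun i j : Fin 2 => if i.val + j.val + 1 = 2 then (1 : L) else 0) v)) γ) + 1 := by
  haveI := hc
  obtain ⟨hSc, hSo⟩ := isCompact_isOpen_comap_map_conj_glInt L w hw D
  obtain ⟨hKc, hKo⟩ := isCompact_isOpen_cmLocalIntegralLevel L 2 (Matrix.of fun i j : Fin 2 => if i.val + j.val + 1 = 2 then (1 : L) else 0) v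
  have hO := isClosed_conjClass_local_of_isRegularElt L 2 (Matrix.of fun i j : Fin 2 => if i.val + j.val + 1 = 2 then (1 : L) else 0) v
    (antidiagOne_isHermitian L 2) (isUnit_antidiagOne_det L 2).ne_zero γ hreg
  obtain ⟨hfinV, hfinE, horb⟩ := finite_fixedBy_quotient_and_of_isClosed γ hO _ _ hSo hSc hKo hKc
  refine TreeAction.natCard_fixedBy_add_eq_natCard_fixedBy_add_one_of_vertexAction hX act act_one act_mul act_adj h01 hV hD _ _ _
    (fun g => ?_) (fun g => ?_) (fun g => ?_) γ hfinV hfinE horb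
  · rw [← hKv]; exact mem_comap_map_conj_glInt_iff L w hw D g
  · rw [← hKe]; exact mem_localIntegralLevel_iff_of_smul_eq (IsCMField.complexConj L) 2 _ (IsCMField.complexConj_ne_one L) w hw g
  · have hK : g ∈ cmLocalIntegralLevel L 2 (Matrix.of fun i j : Fin 2 => if i.val + j.val + 1 = 2 then (1 : L) else 0) v ↔
        s(act g x₀, act g x₁) = s(x₀, x₁) := by
      rw [← hKe]; exact mem_localIntegralLevel_iff_of_smul_eq (IsCMField.complexConj L) 2 _ (IsCMField.complexConj_ne_one L) w hw g
    rw [Subgroup.mem_inf, mem_comap_map_conj_glInt_iff L w hw D g, hKv, hK]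
    -- `g` fixes `x₀` and the edge `{x₀, x₁}` iff it fixes the dart `(x₀, x₁)`
    constructor
    · rintro ⟨h0, he⟩
      refine ⟨h0, ?_⟩
      rw [h0] at he
      rcases Sym2.eq_iff.1 he with ⟨-, h1⟩ | ⟨h1, h2⟩
      · exact h1
      · rw [h2]; exact h1.symm ▸ rfl
    · rintro ⟨h0, h1⟩
      exact ⟨h0, by rw [h0, h1]⟩

include hw in
/-- **(E) AT `(K♯_D, K, K♯_D ⊓ K)` FROM A TREE ACTION WITH `K` THE VERTEX STABILISER AND `K♯_D` THE EDGE STABILISER** (`F_v(√u)`-type wild places: the roles of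
the two lattice stabilisers are swapped, MEMO (S4)); same conclusion (the relation is symmetric in the two vertex-type levels of the barycentric subdivision).
[cite: Kottwitz1988, §2 Theorem 2] [cite: Serre1980Trees, II.1.3] [cite: Tits1979, §2.7] -/
theorem epEllipticRelation_vertexEdgeLevels_of_vertexAction'
    {W : Type*} {X : SimpleGraph W} (hX : X.IsTree) (act : (cmDatum L 2 (Matrix.of fun i j : Fin 2 => if i.val + j.val + 1 = 2 then (1 : L) else 0)).Local v → W → W)
    (act_one : ∀ x : W, act 1 x = x) (act_mul : ∀ (g h : (cmDatum L 2 (Matrix.of fun i j : Fin 2 => if i.val + j.val + 1 = 2 then (1 : L) else 0)).Local v) (x : W), act (g * h) x = act g (act h x))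
    (act_adj : ∀ (g : (cmDatum L 2 (Matrix.of fun i j : Fin 2 => if i.val + j.val + 1 = 2 then (1 : L) else 0)).Local v) (a b : W), X.Adj (act g a) (act g b) ↔ X.Adj a b)
    {x₀ x₁ : W} (h01 : X.Adj x₀ x₁) (hV : ∀ x : W, ∃ g : (cmDatum L 2 (Matrix.of fun i j : Fin 2 => if i.val + j.val + 1 = 2 then (1 : L) else 0)).Local v, act g x₀ = x)
    (hD : ∀ a b : W, X.Adj a b → ∃ g : (cmDatum L 2 (Matrix.of fun i j : Fin 2 => if i.val + j.val + 1 = 2 then (1 : L) else 0)).Local v, act g x₀ = a ∧ act g x₁ = b)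
    (hKv : ∀ g : (cmDatum L 2 (Matrix.of fun i j : Fin 2 => if i.val + j.val + 1 = 2 then (1 : L) else 0)).Local v, (((localNonsplitEquiv (IsCMField.complexConj L) (Matrix.of fun i j : Fin 2 => if i.val + j.val + 1 = 2 then (1 : L) else 0)
          (IsCMField.complexConj_ne_one L) w hw) g : ↥(unitaryGroupOfForm (galAdicCompletionMap (L := L) (IsCMField.complexConj L) hw)
            (placeForm (Matrix.of fun i j : Fin 2 => if i.val + j.val + 1 = 2 then (1 : L) else 0) w.1))) : GL (Fin 2) (w.1.adicCompletion L)) ∈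
        glInt 2 (w.1.adicCompletion L) ↔ act g x₀ = x₀)
    (hKe : ∀ g : (cmDatum L 2 (Matrix.of fun i j : Fin 2 => if i.val + j.val + 1 = 2 then (1 : L) else 0)).Local v, (((localNonsplitEquiv (IsCMField.complexConj L) (Matrix.of fun i j : Fin 2 => if i.val + j.val + 1 = 2 then (1 : L) else 0)
          (IsCMField.complexConj_ne_one L) w hw) g : ↥(unitaryGroupOfForm (galAdicCompletionMap (L := L) (IsCMField.complexConj L) hw)
            (placeForm (Matrix.of fun i j : Fin 2 => if i.val + j.val + 1 = 2 then (1 : L) else 0) w.1))) : GL (Fin 2) (w.1.adicCompletion L)) ∈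
        (glInt 2 (w.1.adicCompletion L)).map (MulAut.conj D).toMonoidHom ↔ s(act g x₀, act g x₁) = s(x₀, x₁))
    (γ : (cmDatum L 2 (Matrix.of fun i j : Fin 2 => if i.val + j.val + 1 = 2 then (1 : L) else 0)).Local v) (hreg : IsRegularElt (γ.val : GL (Fin 2) (UnitaryGroup.LocalRing L v)))
    (hc : CompactSpace (Subgroup.centralizer ({γ} : Set ((cmDatum L 2 (Matrix.of fun i j : Fin 2 => if i.val + j.val + 1 = 2 then (1 : L) else 0)).Local v)))) :
    Nat.card (fixedBy ((cmDatum L 2 (Matrix.of fun i j : Fin 2 => if i.val + j.val + 1 = 2 then (1 : L) else 0)).Local v ⧸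
          (((glInt 2 (w.1.adicCompletion L)).map (MulAut.conj D).toMonoidHom).comap
          (((unitaryGroupOfForm (galAdicCompletionMap (L := L) (IsCMField.complexConj L) hw)
            (placeForm (Matrix.of fun i j : Fin 2 => if i.val + j.val + 1 = 2 then (1 : L) else 0) w.1)).subtype.comp
            (localNonsplitEquiv (IsCMField.complexConj L) (Matrix.of fun i j : Fin 2 => if i.val + j.val + 1 = 2 then (1 : L) else 0)
          (IsCMField.complexConj_ne_one L) w hw).toMonoidHom :
            (cmDatum L 2 (Matrix.of fun i j : Fin 2 => if i.val + j.val + 1 = 2 then (1 : L) else 0)).Local v →* GL (Fin 2) (w.1.adicCompletion L))))) γ) +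
        Nat.card (fixedBy ((cmDatum L 2 (Matrix.of fun i j : Fin 2 => if i.val + j.val + 1 = 2 then (1 : L) else 0)).Local v ⧸
          cmLocalIntegralLevel L 2 (Matrix.of fun i j : Fin 2 => if i.val + j.val + 1 = 2 then (1 : L) else 0) v) γ) =
      Nat.card (fixedBy ((cmDatum L 2 (Matrix.of fun i j : Fin 2 => if i.val + j.val + 1 = 2 then (1 : L) else 0)).Local v ⧸
          ((((glInt 2 (w.1.adicCompletion L)).map (MulAut.conj D).toMonoidHom).comap
          (((unitaryGroupOfForm (galAdicCompletionMap (L := L) (IsCMField.complexConj L) hw)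
            (placeForm (Matrix.of fun i j : Fin 2 => if i.val + j.val + 1 = 2 then (1 : L) else 0) w.1)).subtype.comp
            (localNonsplitEquiv (IsCMField.complexConj L) (Matrix.of fun i j : Fin 2 => if i.val + j.val + 1 = 2 then (1 : L) else 0)
          (IsCMField.complexConj_ne_one L) w hw).toMonoidHom :
            (cmDatum L 2 (Matrix.of fun i j : Fin 2 => if i.val + j.val + 1 = 2 then (1 : L) else 0)).Local v →* GL (Fin 2) (w.1.adicCompletion L)))) ⊓
            cmLocalIntegralLevel L 2 (Matrix.of fun i j : Fin 2 => if i.val + j.val + 1 = 2 then (1 : L) else 0) v)) γ) + 1 := by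
  haveI := hc
  obtain ⟨hSc, hSo⟩ := isCompact_isOpen_comap_map_conj_glInt L w hw D
  obtain ⟨hKc, hKo⟩ := isCompact_isOpen_cmLocalIntegralLevel L 2 (Matrix.of fun i j : Fin 2 => if i.val + j.val + 1 = 2 then (1 : L) else 0) v
  have hO := isClosed_conjClass_local_of_isRegularElt L 2 (Matrix.of fun i j : Fin 2 => if i.val + j.val + 1 = 2 then (1 : L) else 0) v
    (antidiagOne_isHermitian L 2) (isUnit_antidiagOne_det L 2).ne_zero γ hreg
  obtain ⟨hfinV, hfinE, horb⟩ := finite_fixedBy_quotient_and_of_isClosed γ hO _ _ hKo hKc hSo hSc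
  have h := TreeAction.natCard_fixedBy_add_eq_natCard_fixedBy_add_one_of_vertexAction hX act act_one act_mul act_adj h01 hV hD
    (cmLocalIntegralLevel L 2 (Matrix.of fun i j : Fin 2 => if i.val + j.val + 1 = 2 then (1 : L) else 0) v)
    (((glInt 2 (w.1.adicCompletion L)).map (MulAut.conj D).toMonoidHom).comap
          (((unitaryGroupOfForm (galAdicCompletionMap (L := L) (IsCMField.complexConj L) hw)
            (placeForm (Matrix.of fun i j : Fin 2 => if i.val + j.val + 1 = 2 then (1 : L) else 0) w.1)).subtype.comp
            (localNonsplitEquiv (IsCMField.complexConj L) (Matrix.of fun i j : Fin 2 => if i.val + j.val + 1 = 2 then (1 : L) else 0)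
          (IsCMField.complexConj_ne_one L) w hw).toMonoidHom :
            (cmDatum L 2 (Matrix.of fun i j : Fin 2 => if i.val + j.val + 1 = 2 then (1 : L) else 0)).Local v →* GL (Fin 2) (w.1.adicCompletion L))))
    ((((glInt 2 (w.1.adicCompletion L)).map (MulAut.conj D).toMonoidHom).comap
          (((unitaryGroupOfForm (galAdicCompletionMap (L := L) (IsCMField.complexConj L) hw)
            (placeForm (Matrix.of fun i j : Fin 2 => if i.val + j.val + 1 = 2 then (1 : L) else 0) w.1)).subtype.comp
            (localNonsplitEquiv (IsCMField.complexConj L) (Matrix.of fun i j : Fin 2 => if i.val + j.val + 1 = 2 then (1 : L) else 0)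
          (IsCMField.complexConj_ne_one L) w hw).toMonoidHom :
            (cmDatum L 2 (Matrix.of fun i j : Fin 2 => if i.val + j.val + 1 = 2 then (1 : L) else 0)).Local v →* GL (Fin 2) (w.1.adicCompletion L)))) ⊓
      cmLocalIntegralLevel L 2 (Matrix.of fun i j : Fin 2 => if i.val + j.val + 1 = 2 then (1 : L) else 0) v)
    (fun g => ?_) (fun g => ?_) (fun g => ?_) γ hfinV hfinE horb
  · rw [add_comm] at h
    exact h
  · rw [← hKv]; exact mem_localIntegralLevel_iff_of_smul_eq (IsCMField.complexConj L) 2 _ (IsCMField.complexConj_ne_one L) w hw g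
  · rw [← hKe]; exact mem_comap_map_conj_glInt_iff L w hw D g
  · have hK : g ∈ cmLocalIntegralLevel L 2 (Matrix.of fun i j : Fin 2 => if i.val + j.val + 1 = 2 then (1 : L) else 0) v ↔
        act g x₀ = x₀ := by
      rw [← hKv]; exact mem_localIntegralLevel_iff_of_smul_eq (IsCMField.complexConj L) 2 _ (IsCMField.complexConj_ne_one L) w hw g
    rw [Subgroup.mem_inf, mem_comap_map_conj_glInt_iff L w hw D g, hKe, hK]
    constructor
    · rintro ⟨he, h0⟩
      refine ⟨h0, ?_⟩
      rw [h0] at he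
      rcases Sym2.eq_iff.1 he with ⟨-, h1⟩ | ⟨h1, h2⟩
      · exact h1
      · rw [h2]; exact h1.symm ▸ rfl
    · rintro ⟨h0, h1⟩
      exact ⟨by rw [h0, h1], h0⟩

include hw in
/-- **(E) AT `(K♯_D, K, K♯_D ⊓ K)` FROM A TREE ACTION OF THE ONE-PLACE MODEL `U_w = U(σ_w, (Φ₂)_w) ≤ GL₂(L_w)`, `K♯_D`-VERTEX ∕ `K`-EDGE** — the shape in which
(W1c)(W2) are delivered (B-p08 (g28): `rhoVertexAct (u : ↥U_w) : V(X) → V(X)`, `Stab(v₀) = U_w ∩ D·GL₂(𝒪_w)·D⁻¹`, `Stab(e₀) = U_w ∩ GL₂(𝒪_w)`): the action and the two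
stabiliser identifications are keyed on `u : ↥U_w` and transported to `U₂ = U(Φ₂)(L⁺_v)` along `e_w` inside the proof.
[cite: Kottwitz1988, §2 Theorem 2] [cite: Serre1980Trees, II.1.3] [cite: Tits1979, §2.7] -/
theorem epEllipticRelation_vertexEdgeLevels_of_vertexAction_local
    {W : Type*} {X : SimpleGraph W} (hX : X.IsTree)
    (act : ↥(unitaryGroupOfForm (galAdicCompletionMap (L := L) (IsCMField.complexConj L) hw)
            (placeForm (Matrix.of fun i j : Fin 2 => if i.val + j.val + 1 = 2 then (1 : L) else 0) w.1)) → W → W)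
    (act_one : ∀ x : W, act 1 x = x)
    (act_mul : ∀ (u u' : ↥(unitaryGroupOfForm (galAdicCompletionMap (L := L) (IsCMField.complexConj L) hw)
            (placeForm (Matrix.of fun i j : Fin 2 => if i.val + j.val + 1 = 2 then (1 : L) else 0) w.1))) (x : W), act (u * u') x = act u (act u' x))
    (act_adj : ∀ (u : ↥(unitaryGroupOfForm (galAdicCompletionMap (L := L) (IsCMField.complexConj L) hw)
            (placeForm (Matrix.of fun i j : Fin 2 => if i.val + j.val + 1 = 2 then (1 : L) else 0) w.1))) (a b : W), X.Adj (act u a) (act u b) ↔ X.Adj a b)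
    {x₀ x₁ : W} (h01 : X.Adj x₀ x₁)
    (hV : ∀ x : W, ∃ u : ↥(unitaryGroupOfForm (galAdicCompletionMap (L := L) (IsCMField.complexConj L) hw)
            (placeForm (Matrix.of fun i j : Fin 2 => if i.val + j.val + 1 = 2 then (1 : L) else 0) w.1)), act u x₀ = x)
    (hD : ∀ a b : W, X.Adj a b → ∃ u : ↥(unitaryGroupOfForm (galAdicCompletionMap (L := L) (IsCMField.complexConj L) hw)
            (placeForm (Matrix.of fun i j : Fin 2 => if i.val + j.val + 1 = 2 then (1 : L) else 0) w.1)), act u x₀ = a ∧ act u x₁ = b)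
    (hKv : ∀ u : ↥(unitaryGroupOfForm (galAdicCompletionMap (L := L) (IsCMField.complexConj L) hw)
            (placeForm (Matrix.of fun i j : Fin 2 => if i.val + j.val + 1 = 2 then (1 : L) else 0) w.1)),
      (u : GL (Fin 2) (w.1.adicCompletion L)) ∈ (glInt 2 (w.1.adicCompletion L)).map (MulAut.conj D).toMonoidHom ↔ act u x₀ = x₀)
    (hKe : ∀ u : ↥(unitaryGroupOfForm (galAdicCompletionMap (L := L) (IsCMField.complexConj L) hw)
            (placeForm (Matrix.of fun i j : Fin 2 => if i.val + j.val + 1 = 2 then (1 : L) else 0) w.1)),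
      (u : GL (Fin 2) (w.1.adicCompletion L)) ∈ glInt 2 (w.1.adicCompletion L) ↔ s(act u x₀, act u x₁) = s(x₀, x₁))
    (γ : (cmDatum L 2 (Matrix.of fun i j : Fin 2 => if i.val + j.val + 1 = 2 then (1 : L) else 0)).Local v) (hreg : IsRegularElt (γ.val : GL (Fin 2) (UnitaryGroup.LocalRing L v)))
    (hc : CompactSpace (Subgroup.centralizer ({γ} : Set ((cmDatum L 2 (Matrix.of fun i j : Fin 2 => if i.val + j.val + 1 = 2 then (1 : L) else 0)).Local v)))) :
    Nat.card (fixedBy ((cmDatum L 2 (Matrix.of fun i j : Fin 2 => if i.val + j.val + 1 = 2 then (1 : L) else 0)).Local v ⧸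
          (((glInt 2 (w.1.adicCompletion L)).map (MulAut.conj D).toMonoidHom).comap
          (((unitaryGroupOfForm (galAdicCompletionMap (L := L) (IsCMField.complexConj L) hw)
            (placeForm (Matrix.of fun i j : Fin 2 => if i.val + j.val + 1 = 2 then (1 : L) else 0) w.1)).subtype.comp
            (localNonsplitEquiv (IsCMField.complexConj L) (Matrix.of fun i j : Fin 2 => if i.val + j.val + 1 = 2 then (1 : L) else 0)
          (IsCMField.complexConj_ne_one L) w hw).toMonoidHom :
            (cmDatum L 2 (Matrix.of fun i j : Fin 2 => if i.val + j.val + 1 = 2 then (1 : L) else 0)).Local v →* GL (Fin 2) (w.1.adicCompletion L))))) γ) +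
        Nat.card (fixedBy ((cmDatum L 2 (Matrix.of fun i j : Fin 2 => if i.val + j.val + 1 = 2 then (1 : L) else 0)).Local v ⧸
          cmLocalIntegralLevel L 2 (Matrix.of fun i j : Fin 2 => if i.val + j.val + 1 = 2 then (1 : L) else 0) v) γ) =
      Nat.card (fixedBy ((cmDatum L 2 (Matrix.of fun i j : Fin 2 => if i.val + j.val + 1 = 2 then (1 : L) else 0)).Local v ⧸
          ((((glInt 2 (w.1.adicCompletion L)).map (MulAut.conj D).toMonoidHom).comap
          (((unitaryGroupOfForm (galAdicCompletionMap (L := L) (IsCMField.complexConj L) hw)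
            (placeForm (Matrix.of fun i j : Fin 2 => if i.val + j.val + 1 = 2 then (1 : L) else 0) w.1)).subtype.comp
            (localNonsplitEquiv (IsCMField.complexConj L) (Matrix.of fun i j : Fin 2 => if i.val + j.val + 1 = 2 then (1 : L) else 0)
          (IsCMField.complexConj_ne_one L) w hw).toMonoidHom :
            (cmDatum L 2 (Matrix.of fun i j : Fin 2 => if i.val + j.val + 1 = 2 then (1 : L) else 0)).Local v →* GL (Fin 2) (w.1.adicCompletion L)))) ⊓
            cmLocalIntegralLevel L 2 (Matrix.of fun i j : Fin 2 => if i.val + j.val + 1 = 2 then (1 : L) else 0) v)) γ) + 1 :=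
  epEllipticRelation_vertexEdgeLevels_of_vertexAction L w hw D hX
    (fun g => act
      ((localNonsplitEquiv (IsCMField.complexConj L) (Matrix.of fun i j : Fin 2 => if i.val + j.val + 1 = 2 then (1 : L) else 0)
          (IsCMField.complexConj_ne_one L) w hw) g))
    (fun x => by
      -- `e_w 1 = 1`, read through the (definitionally equal) group structures of `U₂` and of the one-place model's source
      have h1 := congrArg (fun u => act u x) (map_one
        (localNonsplitEquiv (IsCMField.complexConj L) (Matrix.of fun i j : Fin 2 => if i.val + j.val + 1 = 2 then (1 : L) else 0)
          (IsCMField.complexConj_ne_one L) w hw))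
      exact h1.trans (act_one x))
    (fun g h x => by
      have h2 := congrArg (fun u => act u x) (map_mul
        (localNonsplitEquiv (IsCMField.complexConj L) (Matrix.of fun i j : Fin 2 => if i.val + j.val + 1 = 2 then (1 : L) else 0)
          (IsCMField.complexConj_ne_one L) w hw) g h)
      exact h2.trans (act_mul _ _ x))
    (fun g a b => act_adj _ a b) h01
    (fun x => by
      obtain ⟨u, hu⟩ := hV x
      exact ⟨(localNonsplitEquiv (IsCMField.complexConj L) (Matrix.of fun i j : Fin 2 => if i.val + j.val + 1 = 2 then (1 : L) else 0)
          (IsCMField.complexConj_ne_one L) w hw).symm u,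
        by simpa only [ContinuousMulEquiv.apply_symm_apply] using hu⟩)
    (fun a b hab => by
      obtain ⟨u, hu⟩ := hD a b hab
      exact ⟨(localNonsplitEquiv (IsCMField.complexConj L) (Matrix.of fun i j : Fin 2 => if i.val + j.val + 1 = 2 then (1 : L) else 0)
          (IsCMField.complexConj_ne_one L) w hw).symm u,
        by simpa only [ContinuousMulEquiv.apply_symm_apply] using hu⟩)
    (fun g => hKv _) (fun g => hKe _) γ hreg hc

include hw in
/-- **(E) AT `(K♯_D, K, K♯_D ⊓ K)` FROM A TREE ACTION OF THE ONE-PLACE MODEL `U_w`, `K`-VERTEX ∕ `K♯_D`-EDGE** (`F_v(√u)`-type wild places): same transport,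
roles swapped. [cite: Kottwitz1988, §2 Theorem 2] [cite: Serre1980Trees, II.1.3] [cite: Tits1979, §2.7] -/
theorem epEllipticRelation_vertexEdgeLevels_of_vertexAction_local'
    {W : Type*} {X : SimpleGraph W} (hX : X.IsTree)
    (act : ↥(unitaryGroupOfForm (galAdicCompletionMap (L := L) (IsCMField.complexConj L) hw)
            (placeForm (Matrix.of fun i j : Fin 2 => if i.val + j.val + 1 = 2 then (1 : L) else 0) w.1)) → W → W)
    (act_one : ∀ x : W, act 1 x = x)
    (act_mul : ∀ (u u' : ↥(unitaryGroupOfForm (galAdicCompletionMap (L := L) (IsCMField.complexConj L) hw)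
            (placeForm (Matrix.of fun i j : Fin 2 => if i.val + j.val + 1 = 2 then (1 : L) else 0) w.1))) (x : W), act (u * u') x = act u (act u' x))
    (act_adj : ∀ (u : ↥(unitaryGroupOfForm (galAdicCompletionMap (L := L) (IsCMField.complexConj L) hw)
            (placeForm (Matrix.of fun i j : Fin 2 => if i.val + j.val + 1 = 2 then (1 : L) else 0) w.1))) (a b : W), X.Adj (act u a) (act u b) ↔ X.Adj a b)
    {x₀ x₁ : W} (h01 : X.Adj x₀ x₁)
    (hV : ∀ x : W, ∃ u : ↥(unitaryGroupOfForm (galAdicCompletionMap (L := L) (IsCMField.complexConj L) hw)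
            (placeForm (Matrix.of fun i j : Fin 2 => if i.val + j.val + 1 = 2 then (1 : L) else 0) w.1)), act u x₀ = x)
    (hD : ∀ a b : W, X.Adj a b → ∃ u : ↥(unitaryGroupOfForm (galAdicCompletionMap (L := L) (IsCMField.complexConj L) hw)
            (placeForm (Matrix.of fun i j : Fin 2 => if i.val + j.val + 1 = 2 then (1 : L) else 0) w.1)), act u x₀ = a ∧ act u x₁ = b)
    (hKv : ∀ u : ↥(unitaryGroupOfForm (galAdicCompletionMap (L := L) (IsCMField.complexConj L) hw)
            (placeForm (Matrix.of fun i j : Fin 2 => if i.val + j.val + 1 = 2 then (1 : L) else 0) w.1)),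
      (u : GL (Fin 2) (w.1.adicCompletion L)) ∈ glInt 2 (w.1.adicCompletion L) ↔ act u x₀ = x₀)
    (hKe : ∀ u : ↥(unitaryGroupOfForm (galAdicCompletionMap (L := L) (IsCMField.complexConj L) hw)
            (placeForm (Matrix.of fun i j : Fin 2 => if i.val + j.val + 1 = 2 then (1 : L) else 0) w.1)),
      (u : GL (Fin 2) (w.1.adicCompletion L)) ∈ (glInt 2 (w.1.adicCompletion L)).map (MulAut.conj D).toMonoidHom ↔
        s(act u x₀, act u x₁) = s(x₀, x₁))
    (γ : (cmDatum L 2 (Matrix.of fun i j : Fin 2 => if i.val + j.val + 1 = 2 then (1 : L) else 0)).Local v) (hreg : IsRegularElt (γ.val : GL (Fin 2) (UnitaryGroup.LocalRing L v)))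
    (hc : CompactSpace (Subgroup.centralizer ({γ} : Set ((cmDatum L 2 (Matrix.of fun i j : Fin 2 => if i.val + j.val + 1 = 2 then (1 : L) else 0)).Local v)))) :
    Nat.card (fixedBy ((cmDatum L 2 (Matrix.of fun i j : Fin 2 => if i.val + j.val + 1 = 2 then (1 : L) else 0)).Local v ⧸
          (((glInt 2 (w.1.adicCompletion L)).map (MulAut.conj D).toMonoidHom).comap
          (((unitaryGroupOfForm (galAdicCompletionMap (L := L) (IsCMField.complexConj L) hw)
            (placeForm (Matrix.of fun i j : Fin 2 => if i.val + j.val + 1 = 2 then (1 : L) else 0) w.1)).subtype.comp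
            (localNonsplitEquiv (IsCMField.complexConj L) (Matrix.of fun i j : Fin 2 => if i.val + j.val + 1 = 2 then (1 : L) else 0)
          (IsCMField.complexConj_ne_one L) w hw).toMonoidHom :
            (cmDatum L 2 (Matrix.of fun i j : Fin 2 => if i.val + j.val + 1 = 2 then (1 : L) else 0)).Local v →* GL (Fin 2) (w.1.adicCompletion L))))) γ) +
        Nat.card (fixedBy ((cmDatum L 2 (Matrix.of fun i j : Fin 2 => if i.val + j.val + 1 = 2 then (1 : L) else 0)).Local v ⧸
          cmLocalIntegralLevel L 2 (Matrix.of fun i j : Fin 2 => if i.val + j.val + 1 = 2 then (1 : L) else 0) v) γ) =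
      Nat.card (fixedBy ((cmDatum L 2 (Matrix.of fun i j : Fin 2 => if i.val + j.val + 1 = 2 then (1 : L) else 0)).Local v ⧸
          ((((glInt 2 (w.1.adicCompletion L)).map (MulAut.conj D).toMonoidHom).comap
          (((unitaryGroupOfForm (galAdicCompletionMap (L := L) (IsCMField.complexConj L) hw)
            (placeForm (Matrix.of fun i j : Fin 2 => if i.val + j.val + 1 = 2 then (1 : L) else 0) w.1)).subtype.comp
            (localNonsplitEquiv (IsCMField.complexConj L) (Matrix.of fun i j : Fin 2 => if i.val + j.val + 1 = 2 then (1 : L) else 0)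
          (IsCMField.complexConj_ne_one L) w hw).toMonoidHom :
            (cmDatum L 2 (Matrix.of fun i j : Fin 2 => if i.val + j.val + 1 = 2 then (1 : L) else 0)).Local v →* GL (Fin 2) (w.1.adicCompletion L)))) ⊓
            cmLocalIntegralLevel L 2 (Matrix.of fun i j : Fin 2 => if i.val + j.val + 1 = 2 then (1 : L) else 0) v)) γ) + 1 :=
  epEllipticRelation_vertexEdgeLevels_of_vertexAction' L w hw D hX
    (fun g => act
      ((localNonsplitEquiv (IsCMField.complexConj L) (Matrix.of fun i j : Fin 2 => if i.val + j.val + 1 = 2 then (1 : L) else 0)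
          (IsCMField.complexConj_ne_one L) w hw) g))
    (fun x => by
      -- `e_w 1 = 1`, read through the (definitionally equal) group structures of `U₂` and of the one-place model's source
      have h1 := congrArg (fun u => act u x) (map_one
        (localNonsplitEquiv (IsCMField.complexConj L) (Matrix.of fun i j : Fin 2 => if i.val + j.val + 1 = 2 then (1 : L) else 0)
          (IsCMField.complexConj_ne_one L) w hw))
      exact h1.trans (act_one x))
    (fun g h x => by
      have h2 := congrArg (fun u => act u x) (map_mul
        (localNonsplitEquiv (IsCMField.complexConj L) (Matrix.of fun i j : Fin 2 => if i.val + j.val + 1 = 2 then (1 : L) else 0)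
          (IsCMField.complexConj_ne_one L) w hw) g h)
      exact h2.trans (act_mul _ _ x))
    (fun g a b => act_adj _ a b) h01
    (fun x => by
      obtain ⟨u, hu⟩ := hV x
      exact ⟨(localNonsplitEquiv (IsCMField.complexConj L) (Matrix.of fun i j : Fin 2 => if i.val + j.val + 1 = 2 then (1 : L) else 0)
          (IsCMField.complexConj_ne_one L) w hw).symm u,
        by simpa only [ContinuousMulEquiv.apply_symm_apply] using hu⟩)
    (fun a b hab => by
      obtain ⟨u, hu⟩ := hD a b hab
      exact ⟨(localNonsplitEquiv (IsCMField.complexConj L) (Matrix.of fun i j : Fin 2 => if i.val + j.val + 1 = 2 then (1 : L) else 0)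
          (IsCMField.complexConj_ne_one L) w hw).symm u,
        by simpa only [ContinuousMulEquiv.apply_symm_apply] using hu⟩)
    (fun g => hKv _) (fun g => hKe _) γ hreg hc

end WildElliptic

end Literature.NumberTheory.Rogawski1990

end
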